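import Summits.CriticalPhenomena.PercolationContinuityZ3.Theorems.PercNearOneGluingAdditiveGluingBlockKernelMix
import HarnessLib

/-! # Crux `PercNearOneGluing.AdditiveGluing` (stmt-CriticalPhenomena-4576), residual kernel — designated peeling and the
# SWITCHING closer (invested seat xfam-a)

Support file (`--supports stmt-CriticalPhenomena-4576`; no definitions, no named facts).  `D_sel(w, o; â)` denotes the DESIGNATED
goodness (engine) inequality `μ_w(â ↔ b) ≤ μ_w(o ↔ b) + Σ_{W ∋ o, W ∩ A = ∅} μ_w(C(o) = W)·μ_w(sel W ↔ b in Wᶜ)`; the block kernel `BK` is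
written as in `…BlockKernelMix.lean`.

* `designated_of_good`: goodness of `(u, A, o, b)` in the skeleton's selection form at its tightest level is `D_sel(u, o; â)` for every
  minimiser `â` of `μ_u(· ↔ b)` over `A` (`goodStep24_functional_eq`).
* `peel_designated` (**designated peeling over an arbitrary sub-star**): for `H ∌ o` and `w⁰ = w` with the pairs `o–h`, `h ∈ H`,
  killed: if `â` is at most as `w⁰`-reliable as every `h ∈ H` and `D_sel(w⁰, o; â)` holds, then `D_sel(w, o; â)`.  This is the internal
  statement of `stub_goodStepLowOnly_k24` (there `H` = the relay neighbours and the input is goodness of `wᴬ`), kept in designated form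
  and for any `H`: the summed peeling lemma `goodStep24_peel_sum` (KN Lemma 5 over the patterns of the `H`-star) + pinning.
* `card_posdeg_killStar_le`: killing pairs does not increase the number of positive-degree vertices.
* `blockKernel_switchA` (**the switching closer, available inside `hresGluedIH` / `hresIH` today**): for a block vertex `x ∈ S`, let
  `g = u/S` and `g⁰ = g` with the pairs `x–a`, `a ∈ A`, killed.  If `(g⁰, A, x, b)` is GOOD (an induction-hypothesis instance: `g⁰` has at
  most as many positive-degree vertices as `u/S`), `â` minimises `μ_{g⁰}(· ↔ b)` over `A`, and `μ_g(a₀ ↔ b) ≤ μ_g(â ↔ b)`, then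
  `BK(u, A, S, b, a₀, sel)`.  ("Observe the glued block from its own vertex `x`; its designated relay `â` is the minimiser after
  killing `x`'s relay pairs; if `a₀` sits below `â` in the glued graph, the residual instance is closed.")
[cite: KozmaNitzan2024, §3.2 (Lemma 5 p. 13, Thms 4–5 pp. 12–14, Question 9 p. 36)]
-/

namespace Summit.CriticalPhenomena.PercolationContinuityZ3.Theorems

open MeasureTheory Set
open Literature.Probability.LatticeModels (prodBernoulli)
open Literature.Probability.Percolation (BondConfig openConn openConnIn openGraph openCluster)
open scoped BigOperators

noncomputable section
open Classical

section Switch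

open Filter
open Literature.Probability.LatticeModels Literature.Probability.Percolation

variable {n : ℕ}

/-- **Goodness at its tightest level is designated goodness.**  If `(u, A, o, b)` is good in selection form (all levels, all
selections) and `â` minimises `μ_u(· ↔ b)` over `A ∋ b`, then `D_sel(u, o; â)` for every selection `sel W ∈ A`.
[cite: KozmaNitzan2024, §3.2 (Definition p. 12)] -/
theorem designated_of_good (u : Sym2 (Fin n) → unitInterval) (A : Finset (Fin n)) (o b â : Fin n)
    (sel : Finset (Fin n) → Fin n) (hb : b ∈ A) (hsel : ∀ W, sel W ∈ A)
    (hmin : ∀ a ∈ A, (prodBernoulli u).real (openConn â b) ≤ (prodBernoulli u).real (openConn a b))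
    (hgood : ∀ (t : ℝ) (sel' : Finset (Fin n) → Fin n), (∀ W, sel' W ∈ A) →
      (∀ a ∈ A, 1 - t ≤ (prodBernoulli u).real (openConn a b)) →
      (prodBernoulli u).real ((⋃ a ∈ A, openConn o a) ∩ (openConn o b)ᶜ)
        + ∑ W ∈ (Finset.univ : Finset (Finset (Fin n))).filter (fun W => o ∈ W ∧ Disjoint W A),
            (prodBernoulli u).real {ω : BondConfig (Fin n) | openCluster ω o = (W : Set (Fin n))}
              * (prodBernoulli u).real (openConnIn ((W : Set (Fin n))ᶜ) (sel' W) b)ᶜ ≤ t) :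
    (prodBernoulli u).real (openConn â b) ≤
      (prodBernoulli u).real (openConn o b)
        + ∑ W ∈ (Finset.univ : Finset (Finset (Fin n))).filter (fun W => o ∈ W ∧ Disjoint W A),
            (prodBernoulli u).real {ω : BondConfig (Fin n) | openCluster ω o = (W : Set (Fin n))}
              * (prodBernoulli u).real (openConnIn ((W : Set (Fin n))ᶜ) (sel W) b) := by
  have h := hgood (1 - (prodBernoulli u).real (openConn â b)) sel hsel (fun a ha => by linarith [hmin a ha])
  rw [goodStep24_functional_eq u A o b hb sel] at h
  linarith

/-- **Designated peeling over an arbitrary sub-star.**  Let `o ∉ H`, `b ≠ o`, `w⁰ = w` with every pair `o–h`, `h ∈ H`, given weight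
`0`.  If `μ_{w⁰}(â ↔ b) ≤ μ_{w⁰}(h ↔ b)` for all `h ∈ H` and `D_sel(w⁰, o; â)`, then `D_sel(w, o; â)`.  Proof: the summed peeling lemma
(`goodStep24_peel_sum`) gives `μ_w(â ↔ b) ≤ μ_w(o ↔ b) + μ_w(σ_∅)·(μ_{w⁰}(â ↔ b) − μ_{w⁰}(o ↔ b))` with `σ_∅` = "no pair `o–H` open";
`D_sel(w⁰)` bounds the bracket by the `w⁰`-pocket sum; `μ_{w⁰}(x ↔ b in Wᶜ) = μ_w(x ↔ b in Wᶜ)` for `W ∋ o`, and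
`μ_w(σ_∅)·μ_{w⁰}(C(o) = W) = μ_w(σ_∅ ∩ {C(o) = W}) ≤ μ_w(C(o) = W)` (pinning the `H`-star closed).
[cite: KozmaNitzan2024, §3.2 (Lemma 5 p. 13 and the proof of Thm 4, pp. 13–14)] -/
theorem peel_designated (w : Sym2 (Fin n) → unitInterval) (A H : Finset (Fin n)) (o b â : Fin n)
    (sel : Finset (Fin n) → Fin n) (hbo : b ≠ o) (hoH : o ∉ H)
    (hle : ∀ h ∈ H, (prodBernoulli (fun e : Sym2 (Fin n) => if (∃ h ∈ H, s(o, h) = e) then 0 else w e)).real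
        (openConn â b) ≤
      (prodBernoulli (fun e : Sym2 (Fin n) => if (∃ h ∈ H, s(o, h) = e) then 0 else w e)).real (openConn h b))
    (heng0 : (prodBernoulli (fun e : Sym2 (Fin n) => if (∃ h ∈ H, s(o, h) = e) then 0 else w e)).real (openConn â b) ≤
      (prodBernoulli (fun e : Sym2 (Fin n) => if (∃ h ∈ H, s(o, h) = e) then 0 else w e)).real (openConn o b)
        + ∑ W ∈ (Finset.univ : Finset (Finset (Fin n))).filter (fun W => o ∈ W ∧ Disjoint W A),
            (prodBernoulli (fun e : Sym2 (Fin n) => if (∃ h ∈ H, s(o, h) = e) then 0 else w e)).real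
                {ω : BondConfig (Fin n) | openCluster ω o = (W : Set (Fin n))}
              * (prodBernoulli (fun e : Sym2 (Fin n) => if (∃ h ∈ H, s(o, h) = e) then 0 else w e)).real
                  (openConnIn ((W : Set (Fin n))ᶜ) (sel W) b)) :
    (prodBernoulli w).real (openConn â b) ≤
      (prodBernoulli w).real (openConn o b)
        + ∑ W ∈ (Finset.univ : Finset (Finset (Fin n))).filter (fun W => o ∈ W ∧ Disjoint W A),
            (prodBernoulli w).real {ω : BondConfig (Fin n) | openCluster ω o = (W : Set (Fin n))}
              * (prodBernoulli w).real (openConnIn ((W : Set (Fin n))ᶜ) (sel W) b) := by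
  set w0 : Sym2 (Fin n) → unitInterval := fun e => if (∃ h ∈ H, s(o, h) = e) then 0 else w e with hw0
  set Fl := (Finset.univ : Finset (Finset (Fin n))).filter (fun W => o ∈ W ∧ Disjoint W A) with hFl
  have hmemFl : ∀ W, W ∈ Fl ↔ o ∈ W ∧ Disjoint W A := fun W => by simp [hFl]
  -- the summed peeling lemma over the `H`-star
  have hpeel := goodStep24_peel_sum n w o b â H hbo hoH hle
  -- `μ_{w⁰}(x ↔ b in Wᶜ) = μ_w(x ↔ b in Wᶜ)` on pockets containing `o`
  have hin : ∀ W ∈ Fl, (prodBernoulli w0).real (openConnIn ((W : Set (Fin n))ᶜ) (sel W) b) =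
      (prodBernoulli w).real (openConnIn ((W : Set (Fin n))ᶜ) (sel W) b) := by
    intro W hW
    refine goodStep24_real_openConnIn_eq w0 w o H W ((hmemFl W).1 hW).1 (sel W) b ?_
    intro e he
    simp only [hw0]
    rw [if_neg he]
  -- `μ_w(σ_∅) · μ_{w⁰}(C(o) = W) ≤ μ_w(C(o) = W)` by pinning the `H`-star closed
  obtain ⟨F, hF⟩ := goodStep24_exists_highStar o H
  have hpin0 : pinW w (↑F : Set (Sym2 (Fin n))) ↑(∅ : Finset (Sym2 (Fin n))) = w0 := by
    funext e
    rw [pinW_apply]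
    by_cases he : e ∈ (↑F : Set (Sym2 (Fin n)))
    · have he' : ∃ h ∈ H, s(o, h) = e := (hF e).1 he
      simp only [hw0]
      rw [if_pos he, if_pos he', Finset.coe_empty, if_neg (Set.notMem_empty e)]
    · have he' : ¬ ∃ h ∈ H, s(o, h) = e := fun h => he ((hF e).2 h)
      simp only [hw0]
      rw [if_neg he, if_neg he']
  have hcyl0 : localCylinder (↑F : Set (Sym2 (Fin n))) ↑(∅ : Finset (Sym2 (Fin n))) =
      {ω : BondConfig (Fin n) | ∀ h ∈ H, s(o, h) ∉ ω} := by
    ext ω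
    simp only [localCylinder, Finset.coe_empty, Set.mem_empty_iff_false, iff_false, Set.mem_setOf_eq]
    constructor
    · intro hω h hh
      exact hω _ ((hF _).2 ⟨h, hh, rfl⟩)
    · intro hω e he
      obtain ⟨h, hh, rfl⟩ := (hF e).1 he
      exact hω h hh
  have hpock : ∀ W ∈ Fl,
      (prodBernoulli w).real {ω : BondConfig (Fin n) | ∀ h ∈ H, s(o, h) ∉ ω} *
          (prodBernoulli w0).real {ω : BondConfig (Fin n) | openCluster ω o = (W : Set (Fin n))} ≤
        (prodBernoulli w).real {ω : BondConfig (Fin n) | openCluster ω o = (W : Set (Fin n))} := by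
    intro W _
    have h := prodBernoulli_real_inter_localCylinder w F (↑(∅ : Finset (Sym2 (Fin n))))
      (A := {ω : BondConfig (Fin n) | openCluster ω o = (W : Set (Fin n))}) MeasurableSet.of_discrete
    rw [hpin0, hcyl0] at h
    rw [← h]
    exact measureReal_mono Set.inter_subset_left (measure_ne_top _ _)
  have hsum : (prodBernoulli w).real {ω : BondConfig (Fin n) | ∀ h ∈ H, s(o, h) ∉ ω} *
      ∑ W ∈ Fl, (prodBernoulli w0).real {ω : BondConfig (Fin n) | openCluster ω o = (W : Set (Fin n))}
          * (prodBernoulli w0).real (openConnIn ((W : Set (Fin n))ᶜ) (sel W) b) ≤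
      ∑ W ∈ Fl, (prodBernoulli w).real {ω : BondConfig (Fin n) | openCluster ω o = (W : Set (Fin n))}
          * (prodBernoulli w).real (openConnIn ((W : Set (Fin n))ᶜ) (sel W) b) := by
    rw [Finset.mul_sum]
    refine Finset.sum_le_sum fun W hW => ?_
    rw [hin W hW, ← mul_assoc]
    exact mul_le_mul_of_nonneg_right (hpock W hW) measureReal_nonneg
  have hσ0 : 0 ≤ (prodBernoulli w).real {ω : BondConfig (Fin n) | ∀ h ∈ H, s(o, h) ∉ ω} :=
    measureReal_nonneg
  have hS0 : 0 ≤ ∑ W ∈ Fl, (prodBernoulli w0).real {ω : BondConfig (Fin n) | openCluster ω o = (W : Set (Fin n))}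
      * (prodBernoulli w0).real (openConnIn ((W : Set (Fin n))ᶜ) (sel W) b) :=
    Finset.sum_nonneg fun _ _ => mul_nonneg measureReal_nonneg measureReal_nonneg
  nlinarith [hpeel, heng0, hsum, hσ0, hS0, mul_le_mul_of_nonneg_left
    (show (prodBernoulli w0).real (openConn â b) - (prodBernoulli w0).real (openConn o b) ≤
      ∑ W ∈ Fl, (prodBernoulli w0).real {ω : BondConfig (Fin n) | openCluster ω o = (W : Set (Fin n))}
        * (prodBernoulli w0).real (openConnIn ((W : Set (Fin n))ᶜ) (sel W) b) by linarith) hσ0]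

/-- Killing the pairs `o–h`, `h ∈ H`, does not increase the number of positive-degree vertices. [folklore] -/
theorem card_posdeg_killStar_le (w : Sym2 (Fin n) → unitInterval) (H : Finset (Fin n)) (o : Fin n) :
    (Finset.univ.filter (fun v : Fin n => ∃ x : Fin n,
        0 < ((fun e : Sym2 (Fin n) => if (∃ h ∈ H, s(o, h) = e) then 0 else w e) s(x, v) : ℝ))).card ≤
      (Finset.univ.filter (fun v : Fin n => ∃ x : Fin n, 0 < (w s(x, v) : ℝ))).card := by
  refine Finset.card_le_card fun v hv => ?_
  simp only [Finset.mem_filter, Finset.mem_univ, true_and] at hv ⊢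
  obtain ⟨x, hx⟩ := hv
  refine ⟨x, ?_⟩
  by_cases he : ∃ h ∈ H, s(o, h) = s(x, v)
  · rw [if_pos he] at hx
    simp at hx
  · rwa [if_neg he] at hx

/-- **The switching closer (form available today).**  Let `S` be the block, `x ∈ S`, `g = u/S` the glued weighting and `g⁰ = g` with the
pairs `x–a`, `a ∈ A`, killed.  If `(g⁰, A, x, b)` is GOOD (selection form, all levels/selections), `â` minimises `μ_{g⁰}(· ↔ b)` over `A`,
and the designated relay `a₀` is at most as `g`-reliable as `â`, then `BK(u, A, S, b, a₀, sel)`.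
Proof: `designated_of_good` for `g⁰`, `peel_designated` with `H = A` (every `h ∈ A` is `g⁰`-above the minimiser `â`), and the switching
leaf `blockKernel_of_designated`. [cite: KozmaNitzan2024, §3.2 (Lemma 5 p. 13, Thm 5 pp. 13–14, Question 9 p. 36)] -/
theorem blockKernel_switchA (u : Sym2 (Fin n) → unitInterval) (A S : Finset (Fin n)) (b a₀ â x : Fin n)
    (sel : Finset (Fin n) → Fin n) (hx : x ∈ S) (hbA : b ∈ A) (hxA : x ∉ A) (hsel : ∀ W, sel W ∈ A)
    (hmin0 : ∀ a ∈ A,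
      (prodBernoulli (fun e : Sym2 (Fin n) => if (∃ h ∈ A, s(x, h) = e) then 0 else
        (fun e : Sym2 (Fin n) => if (∀ z ∈ e, z ∈ S) ∧ ¬ e.IsDiag then 1 else u e) e)).real (openConn â b) ≤
      (prodBernoulli (fun e : Sym2 (Fin n) => if (∃ h ∈ A, s(x, h) = e) then 0 else
        (fun e : Sym2 (Fin n) => if (∀ z ∈ e, z ∈ S) ∧ ¬ e.IsDiag then 1 else u e) e)).real (openConn a b))
    (hgood0 : ∀ (t : ℝ) (sel' : Finset (Fin n) → Fin n), (∀ W, sel' W ∈ A) →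
      (∀ a ∈ A, 1 - t ≤ (prodBernoulli (fun e : Sym2 (Fin n) => if (∃ h ∈ A, s(x, h) = e) then 0 else
        (fun e : Sym2 (Fin n) => if (∀ z ∈ e, z ∈ S) ∧ ¬ e.IsDiag then 1 else u e) e)).real (openConn a b)) →
      (prodBernoulli (fun e : Sym2 (Fin n) => if (∃ h ∈ A, s(x, h) = e) then 0 else
        (fun e : Sym2 (Fin n) => if (∀ z ∈ e, z ∈ S) ∧ ¬ e.IsDiag then 1 else u e) e)).real
          ((⋃ a ∈ A, openConn x a) ∩ (openConn x b)ᶜ)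
        + ∑ W ∈ (Finset.univ : Finset (Finset (Fin n))).filter (fun W => x ∈ W ∧ Disjoint W A),
            (prodBernoulli (fun e : Sym2 (Fin n) => if (∃ h ∈ A, s(x, h) = e) then 0 else
              (fun e : Sym2 (Fin n) => if (∀ z ∈ e, z ∈ S) ∧ ¬ e.IsDiag then 1 else u e) e)).real
                {ω : BondConfig (Fin n) | openCluster ω x = (W : Set (Fin n))}
              * (prodBernoulli (fun e : Sym2 (Fin n) => if (∃ h ∈ A, s(x, h) = e) then 0 else
                (fun e : Sym2 (Fin n) => if (∀ z ∈ e, z ∈ S) ∧ ¬ e.IsDiag then 1 else u e) e)).real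
                  (openConnIn ((W : Set (Fin n))ᶜ) (sel' W) b)ᶜ ≤ t)
    (hle : (prodBernoulli (fun e : Sym2 (Fin n) => if (∀ z ∈ e, z ∈ S) ∧ ¬ e.IsDiag then 1 else u e)).real (openConn a₀ b) ≤
      (prodBernoulli (fun e : Sym2 (Fin n) => if (∀ z ∈ e, z ∈ S) ∧ ¬ e.IsDiag then 1 else u e)).real (openConn â b)) :
    (prodBernoulli u).real (openConn a₀ b)
        + (prodBernoulli u).real ((openConn a₀ b)ᶜ ∩ (⋃ s ∈ S, openConn a₀ s) ∩ (⋃ s ∈ S, openConn s b))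
      ≤ (prodBernoulli u).real (⋃ s ∈ S, openConn s b)
        + ∑ W ∈ (Finset.univ : Finset (Finset (Fin n))).filter (fun W => Disjoint W A),
            (prodBernoulli u).real {ω : BondConfig (Fin n) | ∀ z : Fin n, (z ∈ W ↔ ω ∈ ⋃ s ∈ S, openConn s z)}
              * (prodBernoulli u).real (openConnIn ((W : Set (Fin n))ᶜ) (sel W) b) := by
  set g : Sym2 (Fin n) → unitInterval := fun e => if (∀ z ∈ e, z ∈ S) ∧ ¬ e.IsDiag then 1 else u e with hg
  have hbx : b ≠ x := fun h => hxA (h ▸ hbA)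
  have heng0 := designated_of_good (fun e : Sym2 (Fin n) => if (∃ h ∈ A, s(x, h) = e) then 0 else g e)
    A x b â sel hbA hsel hmin0 hgood0
  have hdes := peel_designated g A A x b â sel hbx hxA (fun h hh => hmin0 h hh) heng0
  exact blockKernel_of_designated u A S b a₀ â x sel hx hle hdes

end Switch

open Filter Literature.Probability.LatticeModels Literature.Probability.Percolation in
/-- Registered helper stub `stub_blockKernelSwitchA_xfa` (invested seat xfam-a) = `blockKernel_switchA`. [cite: KozmaNitzan2024, §3.2 (pp. 12–14)] -/
theorem stub_blockKernelSwitchA_xfa : ∀ (n : ℕ) (u : Sym2 (Fin n) → unitInterval) (A S : Finset (Fin n)) (b a₀ â x : Fin n) (sel : Finset (Fin n) → Fin n), (x ∈ S) → (b ∈ A) → (x ∉ A) → (∀ W, sel W ∈ A) → (∀ a ∈ A, (prodBernoulli (fun e : Sym2 (Fin n) => if (∃ h ∈ A, s(x, h) = e) then 0 else (fun e : Sym2 (Fin n) => if (∀ z ∈ e, z ∈ S) ∧ ¬ e.IsDiag then 1 else u e) e)).real (openConn â b) ≤ (prodBernoulli (fun e : Sym2 (Fin n) => if (∃ h ∈ A,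 s(x, h) = e) then 0 else (fun e : Sym2 (Fin n) => if (∀ z ∈ e, z ∈ S) ∧ ¬ e.IsDiag then 1 else u e) e)).real (openConn a b)) → (∀ (t : ℝ) (sel' : Finset (Fin n) → Fin n), (∀ W, sel' W ∈ A) → (∀ a ∈ A, 1 - t ≤ (prodBernoulli (fun e : Sym2 (Fin n) => if (∃ h ∈ A, s(x, h) = e) then 0 else (fun e : Sym2 (Fin n) => if (∀ z ∈ e, z ∈ S) ∧ ¬ e.IsDiag then 1 else u e) e)).real (openConn a b)) → (prodBernoulli (fun e : Sym2 (Fin n) => if (∃ h ∈ A, s(x, h) = e) then 0 else (fun e : Sym2 (Fin n) => if (∀ z ∈ e, z ∈ S) ∧ ¬ e.IsDiag then 1 else u e) e)).real ((⋃ a ∈ A, openConn x a) ∩ (openConn x b)ᶜ) + ∑ W ∈ (Finset.univ : Finset (Finset (Fin n))).filter (fun W => x ∈ W ∧ Disjoint W A), (prodBernoulli (fun e : Sym2 (Fin n) => if (∃ h ∈ A, s(x, h) = e) then 0 else (fun e : Sym2 (Fin n) => if (∀ z ∈ e, z ∈ S) ∧ ¬ e.IsDiag then 1 else u e) e)).real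 {ω : BondConfig (Fin n) | openCluster ω x = (W : Set (Fin n))} * (prodBernoulli (fun e : Sym2 (Fin n) => if (∃ h ∈ A, s(x, h) = e) then 0 else (fun e : Sym2 (Fin n) => if (∀ z ∈ e, z ∈ S) ∧ ¬ e.IsDiag then 1 else u e) e)).real (openConnIn ((W : Set (Fin n))ᶜ) (sel' W) b)ᶜ ≤ t) → ((prodBernoulli (fun e : Sym2 (Fin n) => if (∀ z ∈ e, z ∈ S) ∧ ¬ e.IsDiag then 1 else u e)).real (openConn a₀ b) ≤ (prodBernoulli (fun e : Sym2 (Fin n) => if (∀ z ∈ e, z ∈ S) ∧ ¬ e.IsDiag then 1 else u e)).real (openConn â b)) → (prodBernoulli u).real (openConn a₀ b) + (prodBernoulli u).real ((openConn a₀ b)ᶜ ∩ (⋃ s ∈ S, openConn a₀ s) ∩ (⋃ s ∈ S, openConn s b)) ≤ (prodBernoulli u).real (⋃ s ∈ S, openConn s b) + ∑ W ∈ (Finset.univ : Finset (Finset (Fin n))).filter (fun W => Disjoint W A), (prodBernoulli u).real {ω : BondConfig (Fin n) | ∀ z : Fin n, (z ∈ W ↔ ω ∈ ⋃ s ∈ S,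 openConn s z)} * (prodBernoulli u).real (openConnIn ((W : Set (Fin n))ᶜ) (sel W) b) :=
  fun _ u A S b a₀ â x sel hx hbA hxA hsel hmin0 hgood0 hle => blockKernel_switchA u A S b a₀ â x sel hx hbA hxA hsel hmin0 hgood0 hle

open Filter Literature.Probability.LatticeModels Literature.Probability.Percolation in
/-- Registered helper stub `stub_peelDesignated_xfa` (invested seat xfam-a) = `peel_designated`. [cite: KozmaNitzan2024, §3.2 (pp. 12–14)] -/
theorem stub_peelDesignated_xfa : ∀ (n : ℕ) (w : Sym2 (Fin n) → unitInterval) (A H : Finset (Fin n)) (o b â : Fin n) (sel : Finset (Fin n) → Fin n), (b ≠ o) → (o ∉ H) → (∀ h ∈ H, (prodBernoulli (fun e : Sym2 (Fin n) => if (∃ h ∈ H, s(o, h) = e) then 0 else w e)).real (openConn â b) ≤ (prodBernoulli (fun e : Sym2 (Fin n) => if (∃ h ∈ H, s(o, h) = e) then 0 else w e)).real (openConn h b)) → ((prodBernoulli (fun e : Sym2 (Fin n) => if (∃ h ∈ H, s(o, h) = e) then 0 else w e)).real (openConn â b) ≤ (prodBernoulli (fun e : Sym2 (Fin n) => if (∃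 h ∈ H, s(o, h) = e) then 0 else w e)).real (openConn o b) + ∑ W ∈ (Finset.univ : Finset (Finset (Fin n))).filter (fun W => o ∈ W ∧ Disjoint W A), (prodBernoulli (fun e : Sym2 (Fin n) => if (∃ h ∈ H, s(o, h) = e) then 0 else w e)).real {ω : BondConfig (Fin n) | openCluster ω o = (W : Set (Fin n))} * (prodBernoulli (fun e : Sym2 (Fin n) => if (∃ h ∈ H, s(o, h) = e) then 0 else w e)).real (openConnIn ((W : Set (Fin n))ᶜ) (sel W) b)) → (prodBernoulli w).real (openConn â b) ≤ (prodBernoulli w).real (openConn o b) + ∑ W ∈ (Finset.univ : Finset (Finset (Fin n))).filter (fun W => o ∈ W ∧ Disjoint W A), (prodBernoulli w).real {ω : BondConfig (Fin n) | openCluster ω o = (W : Set (Fin n))} * (prodBernoulli w).real (openConnIn ((W : Set (Fin n))ᶜ) (sel W) b) :=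
  fun _ w A H o b â sel hbo hoH hle heng0 => peel_designated w A H o b â sel hbo hoH hle heng0

end

end Summit.CriticalPhenomena.PercolationContinuityZ3.Theorems
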